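import Summits.QuantumFields.YangMills.Theorems.BalabanUVNodesN15KingModelRungUnit

/-!
# BalabanUVNodes ∕ N15 — THE KING-MODEL RUNG (PART Ϛ): THE BLOCK-FIELD COVARIANCE IDENTITY `(Δ^{(K)})⁻¹ = a_K⁻¹·1 + Q_K C^η Q_K^*` — NE2's UNIT-LAYER KERNEL OF
# THE MODEL IS WHITE NOISE PLUS THE BLOCK-AVERAGED MASSIVE FREE PROPAGATOR, AND THE NOISE PART's TWO-SPACING RATE IS EXACTLY `L^{−2K}∕a`
# (Track A, DAG node N15 = NE2; FAN-OUT v1.1 §N15 s3 «KING-MODEL RUNG … NE2's analogue DECIDED in the model»)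

HONEST FRAMING.  Count-neutral (cell `pub-ymgap`, seat `pub-ymgap-dag-n15-e` g31; `--supports stmt-QuantumFields-27366 --as helper` = K3⁸
`SpineGivenEndpointR13SepCoPHV`).  TEMPLATE LITERATURE: C. King, *The U(1) Higgs model. I. The continuum limit*, Commun. Math. Phys. **102** (1986) 649–677
[King1986] — KING's OWN `A = 0` MODEL; the operators are the tree's `effLaplacian` (`Δ^{(k)}`, (2.14)∕(4.5)), `Qmat` (block mean (2.10)), `lapF` (`c(−Δ) + m²`,
(4.4); `B⁻¹ = C^η∕N^d` in the tree's normalisation), `aK` ((2.13)), and the rung's g0 objects `blockCov = (Δ^{(K)})⁻¹`, `blockCovStep` (`…N15KingModelRungUnit`).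
NOT Bałaban's `C^{(k)}(Λ)` of [B9] (3.185)–(3.187); NOT a node discharge (N15 is booked through n15-a's knit, untouched here); nothing continuum ∕ ℝ⁴ ∕ OS ∕ mass-gap ∕
Clay.  0 `sorry`; standard axioms; 0 `def`.

THE PRINT AND THE IDENTITY.  King (2.13)–(2.14) p. 653: `G_k = (−Δ^η + m² + a_kQ_k^*Q_k)⁻¹`, `Δ^{(k)} = a_kI − a_k²Q_kG_kQ_k^*`; §4 p. 675 (4.44): `C^η − G^η_K =
C^η(a_KQ^*_KQ_K)G^η_K`, typed in the tree as `King1986.Torus.resolvent_444` with its structural corollary `lapF_inv_transpose_Qmat`: `C^ηQ^*_K = a_KG^η_KQ^*_K·(Δ^{(K)})⁻¹`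
(seat n18-b, `King1986/CovarianceQstar`).  Multiplying by `Q_K` and using (2.14) once more gives the WOODBURY form of (2.14) — the covariance of the `k`-fold block
field under the Gaussian block-spin transformation is the block-spin noise plus the block average of the free covariance:
`(Δ^{(K)})⁻¹ = a_K⁻¹·1 + Q_K C^η Q_K^*` (the rung's g0 docstring for `blockCov` states this reading «i.e. `a_K⁻¹ + Q_KC^ηQ_K^*`»; here it is PROVED).  Consequence for
NE2's unit layer in the model (g0 `blockCovUnit`, its rate `blockCov_step_le` from King's (4.39)–(4.41)): the η-difference `(Δ^{(K+1)})⁻¹ − (Δ^{(K)})⁻¹` splits into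
the DIAGONAL noise term `(a_{K+1}⁻¹ − a_K⁻¹)·δ_{bb′}` — EXACTLY `L^{−2K}∕a` by (2.13)'s formula for `a_k` — plus the two-spacing difference of the block-averaged free
propagators.

WHAT THIS FILE PROVES (kernel).  §1 ★★ **`inv_aK_succ_sub`** (`a_{k+1}⁻¹ − a_k⁻¹ = L^{−2k}∕a`, every `k`; from the tree's `King1986.inv_aK_add`∕`aK_one`).
§2 ★★★ **`effLaplacian_inv_eq_noise_add_blockAvg`** (`(Δ^{(K)})⁻¹ = a⁻¹•1 + N^d•(Q·B⁻¹·Qᵀ)` as matrices on the unit torus, for `N ≥ 1`, `a > 0`, `m² > 0`, `c = N²`).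
§3 (the rung's kernels) ★★ **`blockCov_eq_noise_add_blockAvg`** (`(Δ^{(K)})⁻¹(b, b′) = a_K⁻¹·[b = b′] + N^d·(Q C Qᵀ)(b, b′)`), ★★ **`blockCovStep_eq`** (the unit-layer
η-difference = `(L^{−2K}∕a)·[b = b′]` + the difference of the block-averaged free propagators at the two levels).

HONEST SCOPE.  Identities in King's `A = 0` model on the torus (`c = N²`, i.e. King's `η`-units); nothing is estimated here (the rates remain `blockCov_step_le` ∕
`CovarianceQstarRate`); the block-averaged free propagator's own two-spacing rate is not re-derived.  N15 untouched; counts unmoved.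
Locators: [King1986] (2.10) p.653, (2.13)–(2.14) p.653, (2.16)–(2.17) p.653, (4.4)–(4.5) p.670, (4.39)–(4.41) pp.674–675, (4.44)–(4.45) p.675.
-/

noncomputable section

open scoped BigOperators
open Finset Matrix

namespace Summit.QuantumFields.YangMills.BalabanUVNodes.N15KingModelRung

open Literature.MathematicalPhysics.QuantumFieldTheory.Balaban1983to89.B5Prop11Plancherel (Tor fine)
open Literature.MathematicalPhysics.QuantumFieldTheory.King1986 (aK aK_pos aK_one inv_aK_add)
open Literature.MathematicalPhysics.QuantumFieldTheory.King1986.Torus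

variable {d : ℕ}

/-! ## §1 King's constants `a_k`: the inverse and its exact two-spacing difference -/

section Constants

/-- ★★ **THE NOISE PART's TWO-SPACING RATE, EXACTLY**: `a_{k+1}⁻¹ − a_k⁻¹ = L^{−2k}∕a` (`L > 1`, `a > 0`; every `k`, including `k = 0` where `a_0⁻¹ = 0`,
`a_1 = a`) — the tree's semigroup letter `King1986.inv_aK_add` at `n = 1` with `aK_one`. [cite: King1986, (2.13) p.653] -/
theorem inv_aK_succ_sub {a L : ℝ} (ha : 0 < a) (hL : 1 < L) (k : ℕ) :
    (aK a L (k + 1))⁻¹ - (aK a L k)⁻¹ = (L ^ (2 * k))⁻¹ / a := by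
  rw [inv_aK_add ha hL k 1, aK_one hL]
  ring

end Constants

/-! ## §2 The Woodbury form of (2.14): `(Δ^{(K)})⁻¹ = a⁻¹·1 + Q C Qᵀ` -/

section Identity

variable (N : ℕ) [NeZero N] (M : Fin d → ℕ) [hM : ∀ μ, NeZero (M μ)]

/-- ★★★ **THE BLOCK-FIELD COVARIANCE IDENTITY**: `(Δ^{(K)})⁻¹ = a⁻¹·1 + N^d·(Q B⁻¹ Qᵀ)` — the inverse of King's effective Laplacian `a − a²N^dQA₀⁻¹Qᵀ` is the
block-spin noise `a⁻¹` plus the block average of the massive free covariance `B⁻¹ = (N²(−Δ) + m²)⁻¹` (`N^dB⁻¹ = C^η` in King's normalisation).  From the tree's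
(4.44)-corollary `B⁻¹Qᵀ = a·A₀⁻¹Qᵀ(Δ^{(K)})⁻¹` (`lapF_inv_transpose_Qmat`) and (2.14). [cite: King1986, (2.13)–(2.14) p.653, (4.44)–(4.45) p.675] -/
theorem effLaplacian_inv_eq_noise_add_blockAvg (hN1 : 1 ≤ N) {a m2 : ℝ} (ha : 0 < a) (hm : 0 < m2) :
    (effLaplacian N M a ((N : ℝ) ^ 2) m2)⁻¹
      = a⁻¹ • (1 : Matrix (Tor M) (Tor M) ℝ) + ((N : ℝ) ^ d) • (Qmat N M * (lapF (fine N M) ((N : ℝ) ^ 2) m2)⁻¹ * (Qmat N M)ᵀ) := by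
  set Δ := effLaplacian N M a ((N : ℝ) ^ 2) m2 with hΔdef
  have hdet : IsUnit Δ.det := (Matrix.isUnit_iff_isUnit_det _).mp (effLaplacian_isUnit N M hN1 ha hm)
  -- (2.14): `(aN^d)•(QA₀⁻¹Qᵀ) = 1 − a⁻¹•Δ`
  have h214 : (a * (N : ℝ) ^ d) • (Qmat N M * (fineOp N M a ((N : ℝ) ^ 2) m2)⁻¹ * (Qmat N M)ᵀ) = 1 - a⁻¹ • Δ := by
    rw [hΔdef, effLaplacian, smul_sub, smul_smul, smul_smul, inv_mul_cancel₀ ha.ne', one_smul,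
      show a⁻¹ * (a ^ 2 * (N : ℝ) ^ d) = a * (N : ℝ) ^ d by
        rw [pow_two, mul_assoc, ← mul_assoc a⁻¹, inv_mul_cancel₀ ha.ne', one_mul], sub_sub_cancel]
  -- Woodbury: `N^d•(QB⁻¹Qᵀ) = ((aN^d)•(QA₀⁻¹Qᵀ))·Δ⁻¹ = Δ⁻¹ − a⁻¹•1`
  have key : ((N : ℝ) ^ d) • (Qmat N M * (lapF (fine N M) ((N : ℝ) ^ 2) m2)⁻¹ * (Qmat N M)ᵀ) = Δ⁻¹ - a⁻¹ • (1 : Matrix (Tor M) (Tor M) ℝ) := by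
    rw [Matrix.mul_assoc, lapF_inv_transpose_Qmat N M hN1 ha hm, Matrix.mul_smul, smul_smul, ← hΔdef,
      show Qmat N M * ((fineOp N M a ((N : ℝ) ^ 2) m2)⁻¹ * (Qmat N M)ᵀ * Δ⁻¹)
        = (Qmat N M * (fineOp N M a ((N : ℝ) ^ 2) m2)⁻¹ * (Qmat N M)ᵀ) * Δ⁻¹ by simp only [Matrix.mul_assoc],
      mul_comm ((N : ℝ) ^ d) a, ← Matrix.smul_mul, h214, Matrix.sub_mul, Matrix.one_mul, Matrix.smul_mul, Matrix.mul_nonsing_inv _ hdet]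
  rw [key, add_sub_cancel]

end Identity

/-! ## §3 The rung's NE2 unit-layer kernel: noise + block-averaged free propagator; the η-difference -/

section Rung

variable (L : ℕ) [NeZero L]

omit [NeZero L] in
/-- ★★ **`(Δ^{(K)})⁻¹(b, b′) = a_K⁻¹·[b = b′] + N^d·(Q_K C Q_Kᵀ)(b, b′)`** for the rung's block covariance `blockCov` (`N = Nf ≥ 1` sites per block side,
`a_K = aK a L K > 0`, `m² > 0`). [cite: King1986, (2.13)–(2.14) p.653, (4.44)–(4.45) p.675] -/
theorem blockCov_eq_noise_add_blockAvg (Nf : ℕ) [NeZero Nf] (hNf : 1 ≤ Nf) (M : Fin (d + 1) → ℕ) [∀ μ, NeZero (M μ)] {a m2 : ℝ} {K : ℕ}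
    (haK : 0 < aK a L K) (hm : 0 < m2) (b b' : Tor M) :
    blockCov L Nf M a m2 K b b'
      = (aK a L K)⁻¹ * (if b = b' then 1 else 0)
        + ((Nf : ℕ) : ℝ) ^ (d + 1) * (Qmat Nf M * (lapF (fine Nf M) (((Nf : ℕ) : ℝ) ^ 2) m2)⁻¹ * (Qmat Nf M)ᵀ) b b' := by
  unfold blockCov
  rw [effLaplacian_inv_eq_noise_add_blockAvg Nf M hNf haK hm, Matrix.add_apply, Matrix.smul_apply, Matrix.smul_apply, Matrix.one_apply,
    smul_eq_mul, smul_eq_mul]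

/-- ★★ **THE η-DIFFERENCE OF NE2's UNIT-LAYER KERNEL IN THE MODEL, DECOMPOSED**: `(Δ^{(K+1)})⁻¹(b, b′) − (Δ^{(K)})⁻¹(b, b′) = (L^{−2K}∕a)·[b = b′] +
[N′^dQ_{K+1}C^{η′}Q_{K+1}ᵀ − N^dQ_KC^ηQ_Kᵀ](b, b′)` (`N = L^K`, `N′ = L·L^K`; `L ≥ 2`, `a > 0`, `m² > 0`, `K ≥ 1`) — the diagonal block-spin noise converges at the
EXACT rate `L^{−2K}∕a`; the remainder is the two-spacing difference of the block-averaged massive free propagators (King's (4.39)–(4.41) mechanism acts on it).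
[cite: King1986, (2.13)–(2.14) p.653, (4.39)–(4.41) pp.674–675, (4.44)–(4.45) p.675] -/
theorem blockCovStep_eq (hL : 2 ≤ L) {a m2 : ℝ} (ha : 0 < a) (hm : 0 < m2) (j : KingVolIndex d) (b b' : Tor (kingVol L j)) :
    haveI := kingVol_neZero L j
    blockCovStep L a m2 j b b'
      = ((L : ℝ) ^ (2 * j.K))⁻¹ / a * (if b = b' then 1 else 0)
        + ((((L ^ 1 * L ^ j.K : ℕ) : ℝ) ^ (d + 1))
              * (Qmat (L ^ 1 * L ^ j.K) (kingVol L j) * (lapF (fine (L ^ 1 * L ^ j.K) (kingVol L j)) (((L ^ 1 * L ^ j.K : ℕ) : ℝ) ^ 2) m2)⁻¹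
                  * (Qmat (L ^ 1 * L ^ j.K) (kingVol L j))ᵀ : Matrix (Tor (kingVol L j)) (Tor (kingVol L j)) ℝ) b b'
            - (((L ^ j.K : ℕ) : ℝ) ^ (d + 1))
              * (Qmat (L ^ j.K) (kingVol L j) * (lapF (fine (L ^ j.K) (kingVol L j)) (((L ^ j.K : ℕ) : ℝ) ^ 2) m2)⁻¹
                  * (Qmat (L ^ j.K) (kingVol L j))ᵀ : Matrix (Tor (kingVol L j)) (Tor (kingVol L j)) ℝ) b b') := by
  haveI := kingVol_neZero L j
  have hL1 : (1 : ℝ) < L := by exact_mod_cast (show 1 < L by omega)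
  have hLpos : 0 < L := by omega
  have hN1 : 1 ≤ L ^ j.K := Nat.one_le_pow _ _ hLpos
  have hN1' : 1 ≤ L ^ 1 * L ^ j.K := Nat.one_le_iff_ne_zero.mpr (mul_ne_zero (pow_ne_zero _ hLpos.ne') (pow_ne_zero _ hLpos.ne'))
  have haK : 0 < aK a (L : ℝ) j.K := aK_pos ha hL1 j.one_le_K
  have haK' : 0 < aK a (L : ℝ) (j.K + 1) := aK_pos ha hL1 (by omega)
  unfold blockCovStep
  rw [blockCov_eq_noise_add_blockAvg L (L ^ 1 * L ^ j.K) hN1' (kingVol L j) haK' hm b b',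
    blockCov_eq_noise_add_blockAvg L (L ^ j.K) hN1 (kingVol L j) haK hm b b', ← inv_aK_succ_sub ha hL1 j.K]
  ring

end Rung

end Summit.QuantumFields.YangMills.BalabanUVNodes.N15KingModelRung

end
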